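import Summits.AnomalousDissipation.AnomalousDissipation.Theses.StirringSphere
import Literature.Analysis.FluidPDE.SteadyNavierStokesEnergy

/-!
# Birth skeleton (BC3) — crux `StirringSphere.BoundedSphereStatistics` (stmt-AnomalousDissipation-17145)

Route `route-AnomalousDissipation-StirringSphere` (`closes : NoScreening → BoundedSphereStatistics →
HairyBallAlignment → SphereTransfer → EnsembleRealization → AnomalousDissipation`), item
stmt-AnomalousDissipation-17145, crux rank 3: BOUNDED STATISTICS ON THE WHOLE STIRRING SPHERE — there are
`E, ν₀ > 0` such that every unit `c ∈ ℝ³` and every `ν ∈ (0, ν₀)` admit a Foias–Prodi stationary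
statistical solution `μ` of NS_ν(f_c), `f_c = Σᵢ cᵢ bᵢ` on the explicit 2-sphere of steady forces
(`b₀ = f_GP`, its anti-cyclic cosine partner `b₁`, the shell-2 field `b₂`), with `μ`-integrable mean energy
`∫ ‖u‖² dμ ≤ E` (`Torus.IsStationaryStatisticalSolution`, `Torus.ensembleEnergy`; the energy half of the
ensemble zeroth law, EXISTENTIAL over statistics on the mean-zero space `H`, but UNIFORM over the sphere and
over `ν ∈ (0, ν₀)`). Skeleton registrar planner-skel-stmt-AnomalousDissipation-17145-0, 2026-08-17 (route
re-audit bin REPAIRABLE; `Cruxes/BoundedSphereStatistics/` had no workfile before this one: no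
`Disproof.lean`, no crux ideas, no dead lines).

## The line of this skeleton: CALM EPOCHS OF THE FLOWS STIRRED FROM REST × CALM-EPOCH STATISTICS
## (Krylov–Bogoliubov along the calm epochs; two registered stubs), plus the STEADY/DIRAC alternative

What a bounded stationary statistics of NS_ν(f_c) can be made of, with the tree as it stands: (A) a
generalized long-time average of a Leray–Hopf flow (FMRT 2001, Ch. IV §3: time-average measures are
stationary statistical solutions — PROVED in tree, `timeAverage_isStationary_holds` and the finer lemmas of
`Theorems.TaylorCertificatesEnsembleCeilingTransfer`), or (B) a Dirac mass at a steady weak solution in `V`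
(FMRT IV §1.2 — PROVED in tree, `Torus.isStationaryStatisticalSolution_dirac_holds`). The mean energy of (A)
is the generalized limit of the running means `T⁻¹∫₀ᵀ‖u‖₂²`; since the generalized limit is OURS TO CHOOSE,
only the CALMEST epochs of the flow matter: a flow whose running mean energy dips below `E` infinitely often
already yields a statistics of mean energy `≤ E`. The primary line therefore cuts the crux into

* `stub_calmRestFlows` (THE HEART, open, XL) — ν-UNIFORM CALM EPOCHS FROM REST ON THE SPHERE: `∃ E ν₀ > 0`,
  every unit `c`, every `ν ∈ (0, ν₀)`: SOME global Leray–Hopf solution of NS_ν(f_c) from rest has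
  `T⁻¹∫₀ᵀ‖u‖₂² ≤ E` for arbitrarily large `T` (`∃ᶠ T in atTop`, the junk-free `liminf` form). The weakest
  trajectory statement that feeds the crux; momentum-free by construction (datum `0`, mean-zero force), so
  the Galilean-drift witnesses behind the refuted universal ceilings (negatives 2979 / 2984 / 0204) cannot
  enter, and existential over solutions and data-free, so no universal ceiling is asserted. Why it might
  fail: a laminar-prone direction (the sphere contains the Beltrami/ABC directions `c± = (e₀ ± e₁)/√2`,
  exact laminar steady states of energy `≍ ν⁻²`): rest flows laminarising onto runaway branches at all small
  `ν`. Sources: DoeringFoias2002 §2, FMRTTurbulence2001 Ch. IV, ConstantinTarfuleaVicol2013 p. 3,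
  arXiv:2311.04182 §1.2, the item's grounder/refuter stamps.
* `stub_calmStatistics` (the TRANSFER; known-type, TRUE, size M, claimable now) — CALM-EPOCH STATISTICS: at
  fixed `ν > 0`, for a smooth mean-zero steady force and a global Leray–Hopf flow from rest whose running
  mean energy is `≤ E` infinitely often, some stationary statistical solution has integrable mean energy
  `≤ E`. Print: a generalized limit ATTAINING THE LIMINF of the (eventually bounded) running means — the
  tree's `Theorems.exists_generalizedLimit_apply_eq_limsup` applied to `-h` plus linearity, the one new
  ingredient — then verbatim the landed proof of `Theorems.meanEnergy_le_of_ensembleCeiling`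
  (TaylorCertificates.EnsembleCeilingTransfer, stmt-14092): `H`-lift of the rest flow
  (`Theorems.exists_energySpace_lift_of_isGlobalLerayHopf_zero`), time-average measure for `Λ`
  (`Theorems.exists_isTimeAverageMeasure_of_memLp`, FMRT IV Prop. 3.1), stationarity (FMRT IV Thm. 3.1,
  `Torus.IsTimeAverageMeasure.lintegral_eGradNormSq_lt_top` / `…integrable_generator_and_integral_eq_zero` /
  `…energy_ineq_shell`), energy identity on the carrying Leray ball
  (`Torus.IsTimeAverageMeasure.integral_eq_of_eqOn`, FMRT IV Cor. 3.1): `∫‖v‖²dμ = Λ h = liminf h ≤ E`.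
  Sources: FMRTTurbulence2001 Ch. IV §1.3 Def. 1.4, §3.1 Def. 3.1, Prop. 3.1, Cor. 3.1, Thm. 3.1;
  DoeringFoias2002 §2.

and, as a registered ALTERNATIVE form of the open content (line B, one stub, own composition):

* `stub_boundedSteadySphere` (open, XL, riskier) — ν-UNIFORMLY BOUNDED MOMENTUM-FREE STEADY STATES ON THE
  SPHERE: `∃ E ν₀ > 0`, every unit `c`, every `ν ∈ (0, ν₀)`: a steady weak solution `u ∈ V` (an element of
  the mean-zero space `H` — no Galilean detuning à la `CoherentStates.SteadyBoundedBranch`) of NS_ν(f_c)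
  with `‖u‖₂² ≤ E`; the sphere/continuum analogue of the registered open stub T2' `stub_steadyBoundedSequence`
  of the sibling crux `EnsembleRigidity.GPMeanBoundedFamily` (stmt-15509; GP numerics there inconclusive:
  steady-branch energy 0.19 → 0.86 over Re = 16 → 562). Why it might fail: bounded steady sequences of forced
  periodic NS are an open problem (ConstantinTarfuleaVicol2013 p. 3) and a bounded family would force a
  dissipative steady weak Euler state at EVERY direction of the sphere. Cheapest falsifier: Newton
  continuation in `ν` of the steady branches for ~20 directions (one batched kit job).

PROVED glue (no `sorry`): `sphereForcesAdmissible : StirringSphere.SphereForcesAdmissible` — the route's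
support item stmt-AnomalousDissipation-17149 (every `f_c` is smooth, divergence-free, mean-zero), by the
tactic blocks of the route's own `closes` (rev 4), needed because both compositions want `f_c` smooth
(`∈ L²`) and mean-zero; `boundedStatistics_of_steady` — for `0 ≤ ν`, `f ∈ L²`, a steady weak `u ∈ V`:
`δ_u` is a stationary statistical solution with integrable mean energy `= ‖u‖²`
(`isStationaryStatisticalSolution_dirac_holds`, `Torus.integrable_dirac`, `integral_dirac'`).

Compositions (kernel-checked, sorry-free honest logic): `BoundedSphereStatistics_of :
Sig.stub_calmRestFlows → Sig.stub_calmStatistics → BoundedSphereStatistics` (primary; the SAME `E, ν₀` for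
the whole sphere come from the heart, the transfer is applied force by force) and
`BoundedSphereStatistics_of_steady : Sig.stub_boundedSteadySphere → BoundedSphereStatistics`
(alternative), both concluding the route decl `StirringSphere.BoundedSphereStatistics` BY NAME;
`BoundedSphereStatistics_proof` is the D-0027 §3.3 final shape over the primary line.

Relations recorded (not used by the file): (1) at `c = e₀` (pure Galloway–Proctor force) the heart along a
sequence `ν_j → 0` follows from the sibling crux `EnsembleRigidity.GPMeanBoundedFamily` (15509) restricted to
rest data, and the crux itself at `c = e₀` follows from 15509 by the landed transfer; a refutation of the
heart at `c = e₀` along every sequence refutes the rest form (S7) of 15509's line. (2) Why no finer cut of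
the heart: every analytic split of a ν-uniform energy bound considered (low/high-mode budgets, H⁻¹
interpolation, drag laws) is either ν-dependent (enstrophy is `O(ν⁻¹)`) or asserts a Kolmogorov-type
dissipation LOWER bound, which on this sphere would imply the ensemble zeroth law at every direction — a
costume of the route's target, not a lemma; and pointwise-in-`c` boundedness does not uniformise over the
compact sphere (closed-graph arguments give lower, not upper, semicontinuity of the minimal stationary
energy in `c`). (3) No new route, no new item: this file only registers the skeleton.

## Disproof / negatives honoured

No `Cruxes/BoundedSphereStatistics/Disproof.lean` exists (`ledger crux ls stmt-AnomalousDissipation-17145`: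
no workfiles, 2026-08-17) — nothing to cite; no crux ideas, no dead lines. Item evidence: grounder stamp
(NEW / open for the ν-uniform content; fixed-ν existence + support bound in tree: `fmrt_existence_holds`,
`IsStationaryStatisticalSolution.ae_norm_le`) and refuter route-review stamp (rc 0; not trivial — zero /
sub-probability measures excluded by `.prob`, `δ_0` not stationary for `f ≠ 0`; KEY OBSERVATION: the ABC
directions `c±` lie on the sphere, so the laminar-prone direction of the why-might-fail is ON the sphere;
"only rigorous stationary statistics known for any f: Diracs at steady states and Banach-limit time
averages"). The skeleton answers the stamps structurally: its two forms of the open content are EXACTLY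
those two known sources of stationary statistics (time averages — line A; Diracs — line B), each asked to be
ν-uniformly calm on the whole sphere, and each typed momentum-free. Negatives (`ledger negatives --problem
AnomalousDissipation`, 6 entries 2026-08-17: 14324, 0204, 13037, 2979, 2984, 2859): no stub is an instance —
2979 / 2984 / 0204 are UNIVERSAL ν-uniform ceilings over all data (refuted by Galilean drift of a
non-zero-mean datum); stub 1 is existential over rest flows (zero momentum), stub 3 lives in `H`, stub 2 is a
fixed-ν statement about one flow.

## BC3 audit (seat files `bc/BoundedSphereStatistics_birth.lean` = this file,
## `bc/BoundedSphereStatistics_stub_probes.lean`, `bc/BoundedSphereStatistics_stub_dedup.lean`)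

`lean check --json` on this file: rc 0, errors [], sorries 3 = stubs (`stub_calmRestFlows`,
`stub_calmStatistics`, `stub_boundedSteadySphere`: the only `declaration uses sorry` warnings), zero
elsewhere; `sphereForcesAdmissible` closed (audit class `proof-of-item` for
`StirringSphere.SphereForcesAdmissible`, closed = true), `boundedStatistics_of_steady` closed;
`BoundedSphereStatistics_of` audited `proof.conditional` concluding
`Summit.AnomalousDissipation.AnomalousDissipation.Theses.StirringSphere.BoundedSphereStatistics` BY NAME under
exactly `Sig.stub_calmRestFlows`, `Sig.stub_calmStatistics`, axioms [propext, Classical.choice, Quot.sound];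
`BoundedSphereStatistics_of_steady` `proof.conditional` under exactly `Sig.stub_boundedSteadySphere`;
`BoundedSphereStatistics_proof` class `proof-of-item` (NOT closed: axioms [sorryAx], through the stubs only).
Probes (§1 copied, no sorried theorem and no composition in scope, `maxHeartbeats 400000`): 27/27 FAIL
(rc 1, 27 errors for 27 examples) — for each of the 3 stubs and each target `BoundedSphereStatistics`,
`_root_.AnomalousDissipation`, `Literature.Turb.ZerothLaw`: (a) `first | exact? | simpa | aesop` →
`unsolved goals` with `aesop: failed to prove the goal after exhaustive search`; (b) `simpa [stub]` →
`Tactic assumption failed`; (c) `unfold stub; simpa` → `Tactic assumption failed`. No stub is cheaply the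
crux or the summit (no shredding / costume).

Shape (D-0027 §3.3, as `Cruxes/NoMeanLeakage/Lines/birth.lean`): signatures `Sig.stub_<name> : Prop`,
registered stubs `theorem stub_<name> : Sig.stub_<name> := by sorry`, compositions, `_proof`.

References: C. Foias, O. Manley, R. Rosa, R. Temam, *Navier–Stokes Equations and Turbulence* (CUP 2001),
Ch. IV §1.2 Def. 1.3 and remark after (1.34), §1.3 Def. 1.4, §3.1 Def. 3.1, Prop. 3.1, Cor. 3.1, Thm. 3.1
[FMRTTurbulence2001]; C. Foias, Rend. Sem. Mat. Univ. Padova 48–49 (1972/73) §3 [FoiasPadova1972];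
C. R. Doering, C. Foias, J. Fluid Mech. 467 (2002) §2 [DoeringFoias2002]; P. Constantin, A. Tarfulea,
V. Vicol, arXiv:1305.7089 (2013) p. 3 [ConstantinTarfuleaVicol2013]; A. Cheskidov, arXiv:2311.04182 §1.2
[Cheskidov2023]; R. Temam, *Navier–Stokes Equations* (1979) Ch. II Thm. 1.2 [Temam1979]; E. Hopf, Math.
Nachr. 4 (1951) [Hopf1951]; D. Galloway, U. Frisch, Geophys. Astrophys. Fluid Dyn. 36 (1987) and
O. Podvigina, A. Pouquet, Physica D 75 (1994) (instability of ABC flows) [GallowayFrisch1987,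
PodviginaPouquet1994]; C. Marchioro, Comm. Math. Phys. 105 (1986)
[Literature.Barriers.AnomalousDissipation.Marchioro1986_globalAttraction].
-/

set_option linter.dupNamespace false

noncomputable section

namespace Summit.AnomalousDissipation.AnomalousDissipation.Cruxes.BoundedSphereStatistics.Birth

open scoped BigOperators Topology InnerProductSpace
open MeasureTheory Set Filter Function TopologicalSpace
open Literature.Analysis
open Summit.AnomalousDissipation.AnomalousDissipation.Theses.StirringSphere

/-! ### §1 Signatures of the registered stubs (by name; D-0027 §3.3 shape) -/

/-- STUB 1 — **ν-UNIFORM CALM EPOCHS OF THE FLOWS STIRRED FROM REST ON THE SPHERE** (THE HEART,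
open problem, XL; the trajectory-side energy half of the zeroth law, uniform over the 2-sphere of
forces and over `ν ∈ (0, ν₀)`). There are a level `E > 0` and `ν₀ > 0` such that for every unit
`c` and every `ν ∈ (0, ν₀)` SOME global Leray–Hopf solution `u` of NS_ν(f_c) FROM REST (datum `0`:
zero momentum for all times, so no Galilean drift — the witness that refuted the universal ceilings
2979 / 2984 / 0204 — can enter) is CALM INFINITELY OFTEN IN THE MEAN: its running mean energy
`T⁻¹ ∫₀ᵀ ‖u(t)‖₂² dt` is `≤ E` for arbitrarily large `T` (`∃ᶠ T in atTop`, i.e.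
`liminf_T T⁻¹∫₀ᵀ‖u‖₂² ≤ E`, written junk-free; for Leray–Hopf paths the inner and outer integrals
are honest, `IsGlobalLerayHopf.integrableOn_integral_norm_sq`). This is the WEAKEST statement about
trajectories that yields the crux through the Krylov–Bogoliubov / Foias–Prodi time-average
construction (stub 2): only the calm epochs of the stirred flow are averaged. Strictly weaker than
`meanEnergy u ≤ E` (a `limsup`), than a `ν`-uniform absorbing ball, and than any statement over all
data; at `c = e₀` along a sequence `ν_j → 0` it is implied by the sibling crux
`EnsembleRigidity.GPMeanBoundedFamily` (stmt-AnomalousDissipation-15509) restricted to rest data.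
Why it might fail: exactly the crux's failure mode — a laminar-prone direction of the sphere (the
sphere contains the two Beltrami/ABC directions `c± = (e₀ ± e₁)/√2`, refuter stamp 2026-08-16, where
`u = f_c/(4π²ν)` is an exact steady state of energy `(3/2)/(16π⁴ν²)`): if the flow from rest at some
`c` laminarises onto a runaway branch for all small `ν`, with running means `≍ ν⁻²` from some time
on, the stub is false there while the crux might still hold through a non-rest statistics. No
`ν`-uniform mean-energy bound is known for ANY fixed three-dimensional force (Doering–Foias 2002 §2:
a priori `⟨‖u‖²⟩ ≤ ‖f‖²/(16π⁴ν²)` only; Constantin–Tarfulea–Vicol 2013 p. 3). Sources: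
DoeringFoias2002 §2, FMRTTurbulence2001 Ch. IV §3, ConstantinTarfuleaVicol2013, arXiv:2311.04182
§1.2, Literature.Barriers.AnomalousDissipation.Marchioro1986_globalAttraction (planar gravest-mode
forcing IS laminar with runaway energy — no `f_c` is planar). -/
def Sig.stub_calmRestFlows : Prop :=
  ∀ b : Fin 3 → UnitAddTorus (Fin 3) → EuclideanSpace ℝ (Fin 3), b = ![(fun x : UnitAddTorus (Fin 3) => (Literature.Analysis.FluidPDE.Torus.stokesMode (Pi.single (2 : Fin 3) (1 : ℤ)) (EuclideanSpace.single (0 : Fin 3) (1 : ℝ)) false x + Literature.Analysis.FluidPDE.Torus.stokesMode (Pi.single (0 : Fin 3) (1 : ℤ)) (EuclideanSpace.single (1 : Fin 3) (1 : ℝ)) false x + Literature.Analysis.FluidPDE.Torus.stokesMode (Pi.single (1 : Fin 3) (1 : ℤ)) (EuclideanSpace.single (2 : Fin 3) (1 : ℝ)) false x : EuclideanSpace ℝ (Fin 3))), (fun x : UnitAddTorus (Fin 3) => (Literature.Analysis.FluidPDE.Torus.stokesMode (Pi.single (1 : Fin 3) (1 : ℤ)) (EuclideanSpace.single (0 : Fin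 3) (1 : ℝ)) true x + Literature.Analysis.FluidPDE.Torus.stokesMode (Pi.single (2 : Fin 3) (1 : ℤ)) (EuclideanSpace.single (1 : Fin 3) (1 : ℝ)) true x + Literature.Analysis.FluidPDE.Torus.stokesMode (Pi.single (0 : Fin 3) (1 : ℤ)) (EuclideanSpace.single (2 : Fin 3) (1 : ℝ)) true x : EuclideanSpace ℝ (Fin 3))), (fun x : UnitAddTorus (Fin 3) => (Literature.Analysis.FluidPDE.Torus.stokesMode ![(0 : ℤ), 1, 1] (EuclideanSpace.single (0 : Fin 3) (1 : ℝ)) false x + Literature.Analysis.FluidPDE.Torus.stokesMode ![(1 : ℤ), 0, 1] (EuclideanSpace.single (1 : Fin 3) (1 : ℝ)) false x + Literature.Analysis.FluidPDE.Torus.stokesMode ![(1 : ℤ), 1, 0] (EuclideanSpace.single (2 : Fin 3) (1 : ℝ)) false x : EuclideanSpace ℝ (Fin 3)))] →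
    ∃ E ν₀ : ℝ, 0 < E ∧ 0 < ν₀ ∧ ∀ c : EuclideanSpace ℝ (Fin 3), ‖c‖ = 1 → ∀ ν : ℝ, 0 < ν → ν < ν₀ →
      ∃ u : ℝ → UnitAddTorus (Fin 3) → EuclideanSpace ℝ (Fin 3),
        FluidPDE.Torus.IsGlobalLerayHopf ν
            (fun _ => fun x : UnitAddTorus (Fin 3) => ∑ i : Fin 3, c i • b i x) 0 u ∧
          ∃ᶠ T in atTop, FluidPDE.timeMean (fun t => ∫ x, ‖u t x‖ ^ 2) T ≤ E

/-- STUB 2 — **CALM-EPOCH STATISTICS** (the transfer; known-type, TRUE, size M in Lean: theorem-grade,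
claimable now). For `ν > 0`, a smooth mean-zero steady force `f` on `T³` (divergence-freeness is not
needed: the time-average theory sees `f` only through `f ∈ L²`, and momentum conservation only through
`∫ f = 0`), a global Leray–Hopf solution `u` from rest and a level `E` such that the running mean energy
is `≤ E` for arbitrarily large times: there is a Foias–Prodi stationary statistical solution `μ` of
NS_ν(f) with `μ`-integrable, bounded mean energy `∫ ‖v‖² dμ ≤ E`. Print / tree route: choose a
generalized (Banach) limit `Λ` ATTAINING THE LIMINF of the eventually bounded running means
`h(T) = T⁻¹∫₀ᵀ‖u‖₂²` (apply the tree's `Theorems.exists_generalizedLimit_apply_eq_limsup` to `-h` and use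
linearity of `Λ`, or rerun its ultrafilter construction `exists_generalizedLimit_of_ultrafilter` along
times realising the `liminf`; `liminf h ≤ E` from `∃ᶠ T, h T ≤ E` and boundedness,
`Filter.liminf_le_of_frequently_le`), lift the slices to `H` (`Theorems.exists_energySpace_lift_of_
isGlobalLerayHopf_zero`: from rest every slice is `L²`, weakly divergence free and momentum-free), take
a time-average measure `μ` of the lift for `Λ` (`Theorems.exists_isTimeAverageMeasure_of_memLp`, FMRT
IV Prop. 3.1: tightness by the enstrophy bound (3.4) and Rellich, Riesz representation on the Polish
space `H`), which is a stationary statistical solution (FMRT IV Thm. 3.1; tree: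
`Torus.IsTimeAverageMeasure.lintegral_eGradNormSq_lt_top`, `…integrable_generator_and_integral_eq_zero`,
`…energy_ineq_shell`) carried by the Leray ball (`Torus.IsGlobalLerayHopf.exists_forall_lift_mem_
closedBall`), on which `‖v‖²` agrees with the bounded continuous `min(‖v‖², ρ)`, whence integrability
and `∫‖v‖²dμ = Λ h = liminf h ≤ E` (`Torus.IsTimeAverageMeasure.integral_eq_of_eqOn`, FMRT IV Cor. 3.1,
`Torus.integral_norm_sq_eq_norm_lift_sq`) — verbatim the proof of the landed
`Theorems.meanEnergy_le_of_ensembleCeiling` (TaylorCertificates.EnsembleCeilingTransfer, stmt-14092) with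
`limsup` replaced by `liminf`. Why it might fail: it should not; Lean cost = the liminf-attaining
generalized limit (new, ~40 lines) and the repackaging. Sources: FMRTTurbulence2001 Ch. IV §1.3 Def. 1.4,
§3.1 Def. 3.1, Prop. 3.1, Cor. 3.1, Thm. 3.1; DoeringFoias2002 §2; FoiasPadova1972 §3. -/
def Sig.stub_calmStatistics : Prop :=
  ∀ (ν E : ℝ) (f : UnitAddTorus (Fin 3) → EuclideanSpace ℝ (Fin 3))
    (u : ℝ → UnitAddTorus (Fin 3) → EuclideanSpace ℝ (Fin 3)), 0 < ν →
    FunctionSpaces.Torus.IsSmooth f → FunctionSpaces.Torus.HasZeroMean f →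
    FluidPDE.Torus.IsGlobalLerayHopf ν (fun _ => f) 0 u →
    (∃ᶠ T in atTop, FluidPDE.timeMean (fun t => ∫ x, ‖u t x‖ ^ 2) T ≤ E) →
      ∃ μ : Measure (FunctionSpaces.Torus.energySpace (Fin 3)),
        FluidPDE.Torus.IsStationaryStatisticalSolution ν f μ ∧
          Integrable (fun v : FunctionSpaces.Torus.energySpace (Fin 3) => ‖v‖ ^ 2) μ ∧
          FluidPDE.Torus.ensembleEnergy μ ≤ E

/-- STUB 3 — **ν-UNIFORMLY BOUNDED MOMENTUM-FREE STEADY STATES ON THE SPHERE** (ALTERNATIVE form of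
the open content — the steady/Dirac line; open problem, XL and RISKIER than stub 1; it feeds the crux
on its own through the tree's Dirac theorem, composition `BoundedSphereStatistics_of_steady`). There
are `E, ν₀ > 0` such that every unit `c` and every `ν ∈ (0, ν₀)` admit a steady weak solution
`u ∈ V = H ∩ H¹` of NS_ν(f_c) (`Torus.IsSteadyWeakSolution`: `⟨F(u), w⟩ = 0` for all `w ∈ 𝒱`; `u` is an
element of the MEAN-ZERO energy space `H`, so the Galilean-drift detuning that made
`CoherentStates.SteadyBoundedBranch` (stmt-0221) true-as-typed is excluded) with `‖u‖₂² ≤ E`. The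
sphere analogue, over the continuum `ν ∈ (0, ν₀)`, of the registered open stub T2'
`stub_steadyBoundedSequence` of the sibling crux `EnsembleRigidity.GPMeanBoundedFamily` (c = e₀, a
sequence `ν_j → 0`; numerics LINE-REPORT-c2 there: the primary symmetric steady GP branch has
`∫‖u‖² = 0.19 … 0.86` for `Re = 16 … 562`, growing ≈ 0.1 per octave, fate open). Not a trivial
statement: `u = 0` is not steady (`⟨F(0), f_c⟩ = ‖f_c‖₂² = 3/2`), and the laminar states of the Beltrami
directions `c±` have energy `≍ ν⁻²`. Why it might fail: steady states exist at every `ν`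
(Leray–Schauder; FMRT II §7, Temam 1979 Ch. II Thm. 1.2) but nothing bounds their energy uniformly —
"the existence of bounded sequences of stationary solutions of the periodic, forced Navier–Stokes
equations … are open problems" (Constantin–Tarfulea–Vicol 2013 p. 3); a bounded steady family
`u_ν ⇀ u_E` would produce a steady weak Euler flow absorbing the injection `(f_c, u_E) = lim ν‖∇u_ν‖²`,
i.e. an Onsager-rough dissipative steady Euler state, for EVERY direction of the sphere including the
ABC directions — much more than the crux asks. Cheapest falsifier: pseudo-arclength Newton continuation
in `ν` of the steady branches of NS_ν(f_c) for ~20 directions `c` (one batched kit job), watching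
`∫‖u‖²` versus `Re`. Sources: ConstantinTarfuleaVicol2013 p. 3, Temam1979 Ch. II Thm. 1.2,
FMRTTurbulence2001 Ch. IV §1.2 (remark after (1.34): Dirac masses at steady states are stationary
statistical solutions; tree `Torus.isStationaryStatisticalSolution_dirac_holds`), GallowayFrisch1987 /
PodviginaPouquet1994 (instability of ABC flows, Re ≳ 13). -/
def Sig.stub_boundedSteadySphere : Prop :=
  ∀ b : Fin 3 → UnitAddTorus (Fin 3) → EuclideanSpace ℝ (Fin 3), b = ![(fun x : UnitAddTorus (Fin 3) => (Literature.Analysis.FluidPDE.Torus.stokesMode (Pi.single (2 : Fin 3) (1 : ℤ)) (EuclideanSpace.single (0 : Fin 3) (1 : ℝ)) false x + Literature.Analysis.FluidPDE.Torus.stokesMode (Pi.single (0 : Fin 3) (1 : ℤ)) (EuclideanSpace.single (1 : Fin 3) (1 : ℝ)) false x + Literature.Analysis.FluidPDE.Torus.stokesMode (Pi.single (1 : Fin 3) (1 : ℤ)) (EuclideanSpace.single (2 : Fin 3) (1 : ℝ)) false x : EuclideanSpace ℝ (Fin 3))), (fun x : UnitAddTorus (Fin 3) => (Literature.Analysis.FluidPDE.Torus.stokesMode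 (Pi.single (1 : Fin 3) (1 : ℤ)) (EuclideanSpace.single (0 : Fin 3) (1 : ℝ)) true x + Literature.Analysis.FluidPDE.Torus.stokesMode (Pi.single (2 : Fin 3) (1 : ℤ)) (EuclideanSpace.single (1 : Fin 3) (1 : ℝ)) true x + Literature.Analysis.FluidPDE.Torus.stokesMode (Pi.single (0 : Fin 3) (1 : ℤ)) (EuclideanSpace.single (2 : Fin 3) (1 : ℝ)) true x : EuclideanSpace ℝ (Fin 3))), (fun x : UnitAddTorus (Fin 3) => (Literature.Analysis.FluidPDE.Torus.stokesMode ![(0 : ℤ), 1, 1] (EuclideanSpace.single (0 : Fin 3) (1 : ℝ)) false x + Literature.Analysis.FluidPDE.Torus.stokesMode ![(1 : ℤ), 0, 1] (EuclideanSpace.single (1 : Fin 3) (1 : ℝ)) false x + Literature.Analysis.FluidPDE.Torus.stokesMode ![(1 : ℤ), 1, 0] (EuclideanSpace.single (2 : Fin 3) (1 : ℝ)) false x : EuclideanSpace ℝ (Fin 3)))] →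
    ∃ E ν₀ : ℝ, 0 < E ∧ 0 < ν₀ ∧ ∀ c : EuclideanSpace ℝ (Fin 3), ‖c‖ = 1 → ∀ ν : ℝ, 0 < ν → ν < ν₀ →
      ∃ u : FunctionSpaces.Torus.energySpace (Fin 3),
        (u : Lp (EuclideanSpace ℝ (Fin 3)) 2 (volume : Measure (UnitAddTorus (Fin 3)))) ∈
            FunctionSpaces.Torus.energySpaceV (Fin 3) ∧
          FluidPDE.Torus.IsSteadyWeakSolution ν
            (fun x : UnitAddTorus (Fin 3) => ∑ i : Fin 3, c i • b i x) u ∧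
          ‖u‖ ^ 2 ≤ E

/-! ### §2 Proved glue (no `sorry`) -/

/-- **Every force of the stirring sphere is admissible** — the route's support item
`StirringSphere.SphereForcesAdmissible` (stmt-AnomalousDissipation-17149), PROVED here because both
compositions need `f_c` smooth (`f_c ∈ L²`) and mean-zero (momentum conservation): finite sums of scalar
multiples of transversal Stokes modes `stokesMode k a _` with `k ≠ 0`, `k·a = 0` are smooth, solenoidal
and mean-zero (`isSmooth_stokesMode`, `isDivFree_stokesMode`, `hasZeroMean_stokesMode`; closure under `+`
from the landed `GpAdmissible` lemmas, under scalars from `Torus.divergence_eq_trace_fderiv`,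
`Torus.fderiv_const_smul`, `integral_smul`). The tactic blocks are those of the route's deciding theorem
`closes` (rev 4), verbatim. [folklore] -/
theorem sphereForcesAdmissible : SphereForcesAdmissible := by
  have inner_latticeVec_single : ∀ (k : Fin 3 → ℤ) (i : Fin 3),
      inner ℝ (Literature.Analysis.FunctionSpaces.Torus.latticeVec k) (EuclideanSpace.single i (1 : ℝ)) = (k i : ℝ) := by
    intro k i
    rw [EuclideanSpace.inner_single_right, Literature.Analysis.FunctionSpaces.Torus.latticeVec_apply]; simp
  have mode_admissible : ∀ (k : Fin 3 → ℤ) (i : Fin 3), k i = 0 → k ≠ 0 → ∀ cb : Bool,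
      Literature.Analysis.FunctionSpaces.Torus.IsSmooth ⇑(Literature.Analysis.FluidPDE.Torus.stokesMode k (EuclideanSpace.single i (1 : ℝ)) cb) ∧
        Literature.Analysis.FunctionSpaces.Torus.IsDivFree ⇑(Literature.Analysis.FluidPDE.Torus.stokesMode k (EuclideanSpace.single i (1 : ℝ)) cb) ∧
        Literature.Analysis.FunctionSpaces.Torus.HasZeroMean ⇑(Literature.Analysis.FluidPDE.Torus.stokesMode k (EuclideanSpace.single i (1 : ℝ)) cb) := by
    intro k i hki hk cb
    refine ⟨Literature.Analysis.FluidPDE.Torus.isSmooth_stokesMode _ _ _,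
      Literature.Analysis.FluidPDE.Torus.isDivFree_stokesMode ?_ _,
      Literature.Analysis.FluidPDE.Torus.hasZeroMean_stokesMode hk _ _⟩
    rw [inner_latticeVec_single, hki]; simp
  have add3_admissible : ∀ {u v w : UnitAddTorus (Fin 3) → EuclideanSpace ℝ (Fin 3)},
      (Literature.Analysis.FunctionSpaces.Torus.IsSmooth u ∧ Literature.Analysis.FunctionSpaces.Torus.IsDivFree u ∧ Literature.Analysis.FunctionSpaces.Torus.HasZeroMean u) →
      (Literature.Analysis.FunctionSpaces.Torus.IsSmooth v ∧ Literature.Analysis.FunctionSpaces.Torus.IsDivFree v ∧ Literature.Analysis.FunctionSpaces.Torus.HasZeroMean v) →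
      (Literature.Analysis.FunctionSpaces.Torus.IsSmooth w ∧ Literature.Analysis.FunctionSpaces.Torus.IsDivFree w ∧ Literature.Analysis.FunctionSpaces.Torus.HasZeroMean w) →
      Literature.Analysis.FunctionSpaces.Torus.IsSmooth (fun x => u x + v x + w x) ∧
        Literature.Analysis.FunctionSpaces.Torus.IsDivFree (fun x => u x + v x + w x) ∧
        Literature.Analysis.FunctionSpaces.Torus.HasZeroMean (fun x => u x + v x + w x) := by
    intro u v w hu hv hw
    have huv : Literature.Analysis.FunctionSpaces.Torus.IsSmooth (fun x => u x + v x) := hu.1.add hv.1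
    exact ⟨huv.add hw.1,
      Summit.AnomalousDissipation.AnomalousDissipation.Theorems.SteadyStatesLoudBounded.GpAdmissible.isDivFree_add huv hw.1
        (Summit.AnomalousDissipation.AnomalousDissipation.Theorems.SteadyStatesLoudBounded.GpAdmissible.isDivFree_add hu.1 hv.1 hu.2.1 hv.2.1) hw.2.1,
      Summit.AnomalousDissipation.AnomalousDissipation.Theorems.SteadyStatesLoudBounded.GpAdmissible.hasZeroMean_add huv hw.1
        (Summit.AnomalousDissipation.AnomalousDissipation.Theorems.SteadyStatesLoudBounded.GpAdmissible.hasZeroMean_add hu.1 hv.1 hu.2.2 hv.2.2) hw.2.2⟩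
  -- homogeneity of divergence-freeness and of the zero-mean property, from the torus calculus of the
  -- Statement's own closure (Torus.divergence_eq_trace_fderiv, Torus.fderiv_const_smul, integral_smul):
  -- no import beyond StokesTorus(Proofs) / StatisticalSolution / the landed GpAdmissible lemmas is needed
  have divergence_const_smul : ∀ {u : UnitAddTorus (Fin 3) → EuclideanSpace ℝ (Fin 3)}
      (hu : Literature.Analysis.FunctionSpaces.Torus.IsContDiff 1 u) (a : ℝ) (x : UnitAddTorus (Fin 3)),
      Literature.Analysis.FunctionSpaces.Torus.divergence (fun y => a • u y) x =
        a * Literature.Analysis.FunctionSpaces.Torus.divergence u x := by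
    intro u hu a x
    rw [show (fun y => a • u y) = a • u from rfl,
      Literature.Analysis.FunctionSpaces.Torus.divergence_eq_trace_fderiv (hu.smul a),
      Literature.Analysis.FunctionSpaces.Torus.divergence_eq_trace_fderiv hu,
      Literature.Analysis.FunctionSpaces.Torus.fderiv_const_smul hu a, ContinuousLinearMap.toLinearMap_smul,
      map_smul, smul_eq_mul]
  have smul_admissible : ∀ {u : UnitAddTorus (Fin 3) → EuclideanSpace ℝ (Fin 3)} (a : ℝ),
      (Literature.Analysis.FunctionSpaces.Torus.IsSmooth u ∧ Literature.Analysis.FunctionSpaces.Torus.IsDivFree u ∧ Literature.Analysis.FunctionSpaces.Torus.HasZeroMean u) →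
      Literature.Analysis.FunctionSpaces.Torus.IsSmooth (fun x => a • u x) ∧
        Literature.Analysis.FunctionSpaces.Torus.IsDivFree (fun x => a • u x) ∧
        Literature.Analysis.FunctionSpaces.Torus.HasZeroMean (fun x => a • u x) := by
    intro u a hu
    refine ⟨hu.1.smul a, fun x => ?_, ?_⟩
    · rw [divergence_const_smul (hu.1.isContDiff (by simp)) a x, hu.2.1 x, mul_zero]
    · have h0 : ∫ x, u x = 0 := hu.2.2
      show ∫ x, a • u x = 0
      rw [integral_smul, h0, smul_zero]
  have sum_admissible : ∀ (b : Fin 3 → UnitAddTorus (Fin 3) → EuclideanSpace ℝ (Fin 3)),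
      (∀ i, Literature.Analysis.FunctionSpaces.Torus.IsSmooth (b i) ∧ Literature.Analysis.FunctionSpaces.Torus.IsDivFree (b i) ∧ Literature.Analysis.FunctionSpaces.Torus.HasZeroMean (b i)) →
      ∀ c : EuclideanSpace ℝ (Fin 3),
      Literature.Analysis.FunctionSpaces.Torus.IsSmooth (fun x => ∑ i : Fin 3, c i • b i x) ∧
        Literature.Analysis.FunctionSpaces.Torus.IsDivFree (fun x => ∑ i : Fin 3, c i • b i x) ∧
        Literature.Analysis.FunctionSpaces.Torus.HasZeroMean (fun x => ∑ i : Fin 3, c i • b i x) := by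
    intro b hb c
    have h : (fun x => ∑ i : Fin 3, c i • b i x) = fun x => c 0 • b 0 x + c 1 • b 1 x + c 2 • b 2 x := by
      funext x; rw [Fin.sum_univ_three]
    rw [h]
    exact add3_admissible (smul_admissible (c 0) (hb 0)) (smul_admissible (c 1) (hb 1)) (smul_admissible (c 2) (hb 2))
  rintro b rfl c'
  refine sum_admissible _ ?_ c'
  have hne : ∀ j : Fin 3, (Pi.single j (1 : ℤ) : Fin 3 → ℤ) ≠ 0 := by
    intro j h; have := congr_fun h j; simp at this
  have hk2a : (![(0 : ℤ), 1, 1] : Fin 3 → ℤ) ≠ 0 := by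
    intro h; have := congr_fun h 1; simp at this
  have hk2b : (![(1 : ℤ), 0, 1] : Fin 3 → ℤ) ≠ 0 := by
    intro h; have := congr_fun h 0; simp at this
  have hk2c : (![(1 : ℤ), 1, 0] : Fin 3 → ℤ) ≠ 0 := by
    intro h; have := congr_fun h 0; simp at this
  intro i
  fin_cases i
  · exact add3_admissible
      (mode_admissible (Pi.single (2 : Fin 3) (1 : ℤ)) 0 (by simp) (hne 2) false)
      (mode_admissible (Pi.single (0 : Fin 3) (1 : ℤ)) 1 (by simp) (hne 0) false)
      (mode_admissible (Pi.single (1 : Fin 3) (1 : ℤ)) 2 (by simp) (hne 1) false)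
  · exact add3_admissible
      (mode_admissible (Pi.single (1 : Fin 3) (1 : ℤ)) 0 (by simp) (hne 1) true)
      (mode_admissible (Pi.single (2 : Fin 3) (1 : ℤ)) 1 (by simp) (hne 2) true)
      (mode_admissible (Pi.single (0 : Fin 3) (1 : ℤ)) 2 (by simp) (hne 0) true)
  · exact add3_admissible
      (mode_admissible ![(0 : ℤ), 1, 1] 0 (by simp) hk2a false)
      (mode_admissible ![(1 : ℤ), 0, 1] 1 (by simp) hk2b false)
      (mode_admissible ![(1 : ℤ), 1, 0] 2 (by simp) hk2c false)

/-- **Bounded steady states carry bounded stationary statistics** (FMRT 2001, Ch. IV §1.2, remark after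
(1.34), pp. 181–182; tree `Torus.isStationaryStatisticalSolution_dirac_holds`, fed by Temam's energy
equation of steady weak solutions in `V`, `d ≤ 4`): for `0 ≤ ν`, `f ∈ L²(T³)` and a steady weak solution
`u ∈ V`, the Dirac mass `δ_u` is a stationary statistical solution of NS_ν(f), every observable is
`δ_u`-integrable (`Torus.integrable_dirac`) and its mean energy is `∫ ‖v‖² dδ_u = ‖u‖²`
(`MeasureTheory.integral_dirac'`, the integrand `‖·‖²` being continuous). [cite: FMRTTurbulence2001, Ch. IV §1.2, remark after (1.34)] -/
theorem boundedStatistics_of_steady {ν : ℝ} (hν : 0 ≤ ν)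
    {f : UnitAddTorus (Fin 3) → EuclideanSpace ℝ (Fin 3)} (hf : MemLp f 2 volume)
    {u : FunctionSpaces.Torus.energySpace (Fin 3)}
    (hV : (u : Lp (EuclideanSpace ℝ (Fin 3)) 2 (volume : Measure (UnitAddTorus (Fin 3)))) ∈
      FunctionSpaces.Torus.energySpaceV (Fin 3))
    (hu : FluidPDE.Torus.IsSteadyWeakSolution ν f u) :
    ∃ μ : Measure (FunctionSpaces.Torus.energySpace (Fin 3)),
      FluidPDE.Torus.IsStationaryStatisticalSolution ν f μ ∧
        Integrable (fun v : FunctionSpaces.Torus.energySpace (Fin 3) => ‖v‖ ^ 2) μ ∧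
        FluidPDE.Torus.ensembleEnergy μ = ‖u‖ ^ 2 := by
  refine ⟨Measure.dirac u, ?_, FluidPDE.Torus.integrable_dirac u _, ?_⟩
  · exact FluidPDE.Torus.isStationaryStatisticalSolution_dirac_holds hν hf (by simp) hV hu
  · unfold FluidPDE.Torus.ensembleEnergy
    -- `integral_dirac'` (strongly measurable integrand) avoids the `MeasurableSingletonClass H` search
    exact integral_dirac' _ _ ((continuous_norm.pow 2).stronglyMeasurable)

/-! ### §3 Registered stubs (the only `sorry`s of the file) -/

/-- Registered stub 1 — ν-uniform calm epochs of the flows stirred from rest on the sphere (the heart;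
open problem). -/
theorem stub_calmRestFlows : Sig.stub_calmRestFlows := by
  sorry

/-- Registered stub 2 — calm-epoch statistics (theorem-grade; claimable now). -/
theorem stub_calmStatistics : Sig.stub_calmStatistics := by
  sorry

/-- Registered stub 3 — ν-uniformly bounded momentum-free steady states on the sphere (alternative
heart; open problem, riskier). -/
theorem stub_boundedSteadySphere : Sig.stub_boundedSteadySphere := by
  sorry

/-! ### §4 Compositions (kernel-checked; no `sorry` outside the three stubs) -/

/-- **The skeleton closes the crux BY NAME (primary line A: calm rest flows × calm-epoch statistics)**:
`Sig.stub_calmRestFlows → Sig.stub_calmStatistics → StirringSphere.BoundedSphereStatistics`. The heart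
gives the level `E`, the threshold `ν₀` and, for every unit `c` and `ν ∈ (0, ν₀)`, a Leray–Hopf flow of
NS_ν(f_c) from rest that is calm infinitely often in the mean; `f_c` is smooth and mean-zero
(`sphereForcesAdmissible`); the transfer turns the calm epochs into a stationary statistical solution of
NS_ν(f_c) with integrable mean energy `≤ E` — literally the crux's conclusion, with the SAME `E, ν₀` for
the whole sphere. Honest logic, no analysis hidden in the seam. -/
theorem BoundedSphereStatistics_of :
    Sig.stub_calmRestFlows → Sig.stub_calmStatistics → BoundedSphereStatistics := by
  intro h₁ h₂ b hb
  obtain ⟨E, ν₀, hE, hν₀, H⟩ := h₁ b hb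
  refine ⟨E, ν₀, hE, hν₀, fun c hc ν hν hνlt => ?_⟩
  obtain ⟨u, hu, hcalm⟩ := H c hc ν hν hνlt
  obtain ⟨hs, -, hz⟩ := sphereForcesAdmissible b hb c
  exact h₂ ν E _ u hν hs hz hu hcalm

/-- **Alternative composition (line B: bounded steady sphere branch × Dirac statistics)**:
`Sig.stub_boundedSteadySphere → StirringSphere.BoundedSphereStatistics`, through the PROVED
`boundedStatistics_of_steady` (the Dirac mass at a momentum-free steady weak solution `u ∈ V` of NS_ν(f_c)
is a Foias–Prodi stationary statistical solution of mean energy `‖u‖² ≤ E`) and `sphereForcesAdmissible`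
(`f_c ∈ L²`). One registered stub suffices here because the other half of the line is a tree theorem. -/
theorem BoundedSphereStatistics_of_steady :
    Sig.stub_boundedSteadySphere → BoundedSphereStatistics := by
  intro h b hb
  obtain ⟨E, ν₀, hE, hν₀, H⟩ := h b hb
  refine ⟨E, ν₀, hE, hν₀, fun c hc ν hν hνlt => ?_⟩
  obtain ⟨u, hV, hsteady, hEu⟩ := H c hc ν hν hνlt
  obtain ⟨hs, -, -⟩ := sphereForcesAdmissible b hb c
  obtain ⟨μ, hstat, hint, hEμ⟩ := boundedStatistics_of_steady hν.le (hs.memLp 2) hV hsteady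
  exact ⟨μ, hstat, hint, hEμ.le.trans hEu⟩

/-- The skeleton in its final shape (D-0027 §3.3): the crux BY NAME from the two registered stubs of
the primary line; it becomes the crux proof when the last `stub_*` is discharged (until then it depends on
`sorryAx` through the stubs only — no `sorry` of its own). -/
theorem BoundedSphereStatistics_proof : BoundedSphereStatistics :=
  BoundedSphereStatistics_of stub_calmRestFlows stub_calmStatistics

end Summit.AnomalousDissipation.AnomalousDissipation.Cruxes.BoundedSphereStatistics.Birth

end
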